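import Mathlib
import Literature.Computability.AlgebraicComplexity.HessianRank
import Summits.ValiantsHypothesis.ValiantsHypothesis.Theorems.GrenetZeonPolySizeQPAlgebraLocalReduction
import HarnessLib

/-!
# Crux `GrenetZeon.PolySizeQPAlgebra` (stmt-ValiantsHypothesis-8064), line `vbp-slice-dealg` —
# the local Hessian bound at points of RESIDUAL CORANK ONE, for EVERY coefficient algebra

`…LocalReduction` reduces every point `(n, s)` of the `c = 1` box to a good `(s+1)`-space and the
inlined hypothesis `LocalHessianBound n`: for a piece `(R, λ, A, F = λ(det A))` and a point `p` with
`det A(p) = 0` in `R`, `rank Hess F(p) ≤ 2 · dim R · n`.  The tree proves it for curvilinear `R`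
(`rank_hess0_jet_le`).  This file proves it for an ARBITRARY finite-dimensional commutative `ℂ`-algebra
`R` (no locality, no nondegeneracy of `λ`, affine rather than linear entries) at every point `p` where
some `(n-1) × (n-1)` minor of the value matrix `A(p) ∈ Mat_n(R)` is a unit — for a local `R`, exactly the
points where the residual matrix `A(p) mod 𝔪` has corank one (`…_of_residual_ne_zero`), i.e. the generic
points of `{det_R A = 0}`:

* `hess0_transl_readOut` — the Hessian of the read-out `F` at `p` is `λ` of the `R`-valued second
  partials of `det A` at `p` (read-outs commute with `∂` and with evaluation at `ℂ`-points).
* `rank_readOut_mul_le` — a matrix `(s, t) ↦ λ(α_s · γ_t)` (`α, γ : σ → R`) has rank `≤ dim R`: it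
  factors through `R`.
* `rank_hess0_transl_le_of_isUnit_adjugate` — **the bound `rank Hess F(p) ≤ 2 · dim R · n`** at such `p`.
  Proof: a row `w` of `adj A(p)` containing the unit satisfies `wᵀ A(p) = 0` (`adj B · B = det B = 0`);
  by multilinearity `w_{j₀} · det A = Σ_k v_k · adj(A)_{k j₀}` with `v_k = Σ_i w_i A_{ik}` affine and
  vanishing at `p`; the product rule at `p` leaves only `∂v_k ⊗ ∂adj(A)_{k j₀} + transpose`, so
  `Hess F(p) = Σ_k (G_k + G_kᵀ)` with `G_k(s,t) = λ(w_{j₀}⁻¹ ∂_s v_k(p) · ∂_t adj(A)_{kj₀}(p))` of rank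
  `≤ dim R` each (Mignon–Ressayre's argument for `R = ℂ`, run through the functional).
* `rank_hess0_transl_le_of_residual_ne_zero` — the same with the hypothesis stated residually through a
  character `φ` with nilpotent kernel: some `(n-1)`-minor of `φ(A(p))` is non-zero.
* `rank_hess0_transl_le_of_vecMul_eq_zero` / `…_of_mulVec_eq_zero` (appended) — the same bound from ANY
  left (right) kernel vector of `A(p)` with a unit coordinate; this is all the proof uses, and it also
  covers residual corank `≥ 2` points such as `A(p) ≃ diag(1_k, 0_q)`.

So of the type-independent input `LocalHessianBound n` exactly the points of residual corank `≥ 2`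
(all `(n-1)`-minors of `A(p)` in `𝔪`) remain.  HONEST FRAMING: a rank count at generic points; no stub
of the line is closed; VP ≠ VNP is not moved.

References: T. Mignon, N. Ressayre, IMRN 2004:79, §2 (the case `R = ℂ`) [MignonRessayre2004];
P. Hrubeš, A. Yehudayoff, Theory of Computing 7 (2011), §2 (extension-ring accounting)
[HrubesYehudayoff2011].
-/

noncomputable section

open MvPolynomial Matrix
open Literature.Computability.AlgebraicComplexity

-- single-conjunct layout `Summits/ValiantsHypothesis/ValiantsHypothesis`: duplicated namespace by design
set_option linter.dupNamespace false

namespace Summit.ValiantsHypothesis.ValiantsHypothesis.Theorems.GrenetZeonPolySizeQPAlgebra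

open Summit.ValiantsHypothesis.ValiantsHypothesis.Cruxes.TwoDimCoefficients.DimTwoCases
  (coeff_sum_monomial_support)

/-! ### Read-outs commute with partial derivatives and evaluation -/

section ReadOut

variable {σ : Type*} {R : Type*} [CommRing R] [Algebra ℂ R]

/-- If `F` is the coefficientwise read-out `λ(q)` then `∂_t F` is the read-out of `∂_t q`
(the integer factors of `∂` commute with the `ℂ`-linear `λ`). [folklore] -/
theorem readOut_pderiv (l : R →ₗ[ℂ] ℂ) {q : MvPolynomial σ R} {F : MvPolynomial σ ℂ}
    (hF : ∀ d, l (coeff d q) = coeff d F) (t : σ) (d : σ →₀ ℕ) :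
    l (coeff d (pderiv t q)) = coeff d (pderiv t F) := by
  rw [coeff_pderiv, coeff_pderiv, ← hF]
  have h1 : coeff (d + Finsupp.single t 1) q * ((d t : R) + 1) =
      (d t + 1) • coeff (d + Finsupp.single t 1) q := by
    rw [nsmul_eq_mul', Nat.cast_succ]
  have h2 : l (coeff (d + Finsupp.single t 1) q) * ((d t : ℂ) + 1) =
      (d t + 1) • l (coeff (d + Finsupp.single t 1) q) := by
    rw [nsmul_eq_mul', Nat.cast_succ]
  rw [h1, h2, map_nsmul]

/-- The value of the read-out `F = λ(q)` at a `ℂ`-point `p` is `λ` of the value of `q` at `p`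
(computed in `R`). [folklore] -/
theorem eval_readOut (l : R →ₗ[ℂ] ℂ) {q : MvPolynomial σ R} {F : MvPolynomial σ ℂ}
    (hF : ∀ d, l (coeff d q) = coeff d F) (p : σ → ℂ) :
    eval p F = l (eval (fun i => algebraMap ℂ R (p i)) q) := by
  classical
  have hFsum : F = ∑ d ∈ q.support, monomial d (l (q.coeff d)) := by
    refine MvPolynomial.ext _ _ fun d => ?_
    rw [coeff_sum_monomial_support]
    split_ifs with hd
    · exact (hF d).symm
    · rw [← hF d, notMem_support_iff.1 hd, map_zero]
  rw [hFsum, eval_sum_monomial_support_eq]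

/-- **The Hessian of a read-out.** If `F = λ(q)` coefficientwise then the Hessian of `F` at a
`ℂ`-point `p` is `λ` of the `R`-valued second partial derivatives of `q` at `p`. [folklore] -/
theorem hess0_transl_readOut (l : R →ₗ[ℂ] ℂ) {q : MvPolynomial σ R} {F : MvPolynomial σ ℂ}
    (hF : ∀ d, l (coeff d q) = coeff d F) (p : σ → ℂ) (s t : σ) :
    hess0 (transl p F) s t =
      l (eval (fun i => algebraMap ℂ R (p i)) (pderiv s (pderiv t q))) := by
  rw [hess0_transl]
  exact eval_readOut l (fun d => readOut_pderiv l (fun d' => readOut_pderiv l hF t d') s d) p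

end ReadOut

/-! ### Second derivatives of products with an affine factor vanishing at the point -/

section Affine

variable {σ : Type*} {R : Type*} [CommRing R]

/-- Product rule at a point for `v · c` with `v` affine and `v(x) = 0`: only the two mixed terms
`∂_t v(x) ∂_s c(x) + ∂_s v(x) ∂_t c(x)` survive in `∂_s ∂_t (v c)(x)` (affine forms have no
second derivatives: `pderiv_pderiv_eq_zero_of_totalDegree_le_one` of the `HessianRank` file). [folklore] -/
theorem eval_pderiv_pderiv_mul_of_affine (x : σ → R) {v : MvPolynomial σ R} (c : MvPolynomial σ R)
    (hv : v.totalDegree ≤ 1) (hv0 : eval x v = 0) (s t : σ) :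
    eval x (pderiv s (pderiv t (v * c))) =
      eval x (pderiv t v) * eval x (pderiv s c) + eval x (pderiv s v) * eval x (pderiv t c) := by
  simp only [pderiv_mul, map_add, map_mul, pderiv_pderiv_eq_zero_of_totalDegree_le_one hv, hv0,
    zero_mul, zero_add, add_zero]

end Affine

/-! ### Matrices `λ(α_s γ_t)` factor through `R` -/

section Factor

variable {σ : Type*} [Fintype σ] {R : Type*} [CommRing R] [Algebra ℂ R] [Module.Finite ℂ R]

/-- For `α, γ : σ → R` and a functional `λ`, the matrix `(s, t) ↦ λ(α_s γ_t)` factors as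
`P · Q` through `ℂ^{dim R}` (coordinates of `α_s` in a basis, and `λ(b_j γ_t)`), hence has rank
`≤ dim R`. [folklore] -/
theorem rank_readOut_mul_le (l : R →ₗ[ℂ] ℂ) (α γ : σ → R) :
    (Matrix.of fun s t => l (α s * γ t)).rank ≤ Module.finrank ℂ R := by
  classical
  set b := Module.finBasis ℂ R with hb
  set P : Matrix σ (Fin (Module.finrank ℂ R)) ℂ := Matrix.of fun s j => b.repr (α s) j with hP
  set Q : Matrix (Fin (Module.finrank ℂ R)) σ ℂ := Matrix.of fun j t => l (b j * γ t) with hQ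
  have hPQ : (Matrix.of fun s t => l (α s * γ t)) = P * Q := by
    ext s t
    rw [Matrix.mul_apply]
    simp only [hP, hQ, Matrix.of_apply]
    conv_lhs => rw [← b.sum_repr (α s)]
    rw [Finset.sum_mul, map_sum]
    refine Finset.sum_congr rfl fun j _ => ?_
    rw [smul_mul_assoc, map_smul, smul_eq_mul]
  rw [hPQ]
  exact (Matrix.rank_mul_le_right P Q).trans
    ((Matrix.rank_le_card_height Q).trans (Fintype.card_fin _).le)

end Factor

/-! ### Two algebraic identities -/

section Identities

variable {S T : Type*} [CommRing S] [CommRing T] [Algebra S T] {n : ℕ}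

/-- Multilinearity of `det` in a row, through the adjugate: replacing row `j₀` of `A` by the
combination `Σ_i w_i · (row i)` multiplies the determinant by `w_{j₀}`:
`Σ_k (Σ_i w_i A_{ik}) adj(A)_{k j₀} = w_{j₀} det A` (scalars `w_i` from a coefficient ring `S`).
[folklore] -/
theorem sum_sum_smul_mul_adjugate_eq (w : Fin n → S) (A : Matrix (Fin n) (Fin n) T) (j₀ : Fin n) :
    ∑ k, (∑ i, w i • A i k) * A.adjugate k j₀ = w j₀ • A.det := by
  have h1 : ∀ i, ∑ k, A i k * A.adjugate k j₀ =
      (A.det • (1 : Matrix (Fin n) (Fin n) T)) i j₀ := fun i => by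
    rw [← Matrix.mul_adjugate, Matrix.mul_apply]
  have h2 : ∀ i, w i • (A.det • (1 : Matrix (Fin n) (Fin n) T)) i j₀ =
      if i = j₀ then w j₀ • A.det else 0 := by
    intro i
    rw [Matrix.smul_apply, Matrix.one_apply]
    split_ifs with h
    · rw [h, smul_eq_mul, mul_one]
    · rw [smul_eq_mul, mul_zero, smul_zero]
  calc ∑ k, (∑ i, w i • A i k) * A.adjugate k j₀
      = ∑ k, ∑ i, w i • (A i k * A.adjugate k j₀) := by
        refine Finset.sum_congr rfl fun k _ => ?_
        simp only [Finset.sum_mul, smul_mul_assoc]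
    _ = ∑ i, w i • ∑ k, A i k * A.adjugate k j₀ := by
        rw [Finset.sum_comm]
        exact Finset.sum_congr rfl fun i _ => Finset.smul_sum.symm
    _ = ∑ i, w i • (A.det • (1 : Matrix (Fin n) (Fin n) T)) i j₀ :=
        Finset.sum_congr rfl fun i _ => by rw [h1]
    _ = w j₀ • A.det := by
        simp only [h2, Finset.sum_ite_eq', Finset.mem_univ, if_true]

end Identities

section RankCount

variable {σ : Type*} [Fintype σ] {R : Type*} [CommRing R] [Algebra ℂ R] [Module.Finite ℂ R] {n : ℕ}

/-- If `H(s,t) = Σ_{k<n} (λ(c α_{kt} γ_{ks}) + λ(c α_{ks} γ_{kt}))` then `H = Σ_k (G_kᵀ + G_k)` with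
`G_k(s,t) = λ((c α_{ks}) γ_{kt})` of rank `≤ dim R` each, so `rank H ≤ 2 · dim R · n`. [folklore] -/
theorem rank_le_of_eq_sum_readOut (l : R →ₗ[ℂ] ℂ) (c : R) (α γ : Fin n → σ → R) (H : Matrix σ σ ℂ)
    (hH : ∀ s t, H s t = ∑ k, (l (c * α k t * γ k s) + l (c * α k s * γ k t))) :
    H.rank ≤ 2 * Module.finrank ℂ R * n := by
  set G : Fin n → Matrix σ σ ℂ := fun k => Matrix.of fun s t => l (c * α k s * γ k t) with hG
  have hGk : ∀ k, (G k).rank ≤ Module.finrank ℂ R := fun k =>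
    rank_readOut_mul_le l (fun s => c * α k s) (γ k)
  have hHG : H = ∑ k, ((G k)ᵀ + G k) := by
    ext s t
    rw [hH s t, Matrix.sum_apply]
    rfl
  rw [hHG]
  refine (rank_sum_le _ _).trans ?_
  calc ∑ k, ((G k)ᵀ + G k).rank ≤ ∑ _k : Fin n, 2 * Module.finrank ℂ R := by
        refine Finset.sum_le_sum fun k _ => (rank_add_le _ _).trans ?_
        have h1 := hGk k
        have h2 : (G k)ᵀ.rank ≤ Module.finrank ℂ R := by rw [Matrix.rank_transpose]; exact hGk k
        omega
    _ = 2 * Module.finrank ℂ R * n := by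
        rw [Finset.sum_const, Finset.card_univ, Fintype.card_fin, smul_eq_mul]
        ring

end RankCount

/-! ### The bound at points of residual corank one -/

section Main

variable {σ : Type*} {R : Type*} [CommRing R] [Algebra ℂ R]

omit [Algebra ℂ R] in
/-- **Second partials of `det A` at a point with a left kernel vector.**  If `wᵀ A(x) = 0` for a
row vector `w ∈ Rⁿ` and `A` is affine, then for all `s, t`:
`w_{j₀} · ∂_s∂_t det A (x) = Σ_k (∂_t v_k(x) ∂_s c_k(x) + ∂_s v_k(x) ∂_t c_k(x))` with
`v_k = Σ_i w_i A_{ik}` (affine, vanishing at `x`) and `c_k = adj(A)_{k j₀}`. [cite: MignonRessayre2004, §2] -/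
theorem mul_eval_pderiv_pderiv_det_eq {n : ℕ} (x : σ → R)
    (A : Matrix (Fin n) (Fin n) (MvPolynomial σ R)) (hA : ∀ a b, (A a b).totalDegree ≤ 1)
    (w : Fin n → R) (hw : ∀ k, ∑ i, w i * eval x (A i k) = 0) (j₀ : Fin n) (s t : σ) :
    w j₀ * eval x (pderiv s (pderiv t A.det)) =
      ∑ k, (eval x (pderiv t (∑ i, w i • A i k)) * eval x (pderiv s (A.adjugate k j₀)) +
        eval x (pderiv s (∑ i, w i • A i k)) * eval x (pderiv t (A.adjugate k j₀))) := by
  have hvdeg : ∀ k, (∑ i, w i • A i k).totalDegree ≤ 1 := fun k =>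
    totalDegree_finsetSum_le fun i _ => (totalDegree_smul_le _ _).trans (hA i k)
  have hv0 : ∀ k, eval x (∑ i, w i • A i k) = 0 := by
    intro k
    simp only [map_sum, smul_eval]
    exact hw k
  have hident := sum_sum_smul_mul_adjugate_eq w A j₀
  have h := congrArg (fun f => eval x (pderiv s (pderiv t f))) hident
  simp only [Derivation.map_smul, smul_eval, map_sum] at h
  rw [← h]
  exact Finset.sum_congr rfl fun k _ => eval_pderiv_pderiv_mul_of_affine x _ (hvdeg k) (hv0 k) s t

variable [Fintype σ] [Module.Finite ℂ R]

/-- **Local Hessian bound at residual corank one, every coefficient algebra.**  Let `R` be any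
finite-dimensional commutative `ℂ`-algebra, `λ : R → ℂ` any linear functional, `A` an `n × n` matrix
of affine forms over `R` with read-out `F = λ(det A)` coefficientwise, and `p` a point with
`det A(p) = 0` in `R` such that some entry of `adj A(p)` — an `(n-1) × (n-1)` minor of the value
matrix — is a unit of `R`.  Then `rank Hess F(p) ≤ 2 · dim_ℂ R · n`.  For `R = ℂ` this is
Mignon–Ressayre's bound at a corank-one point. [cite: MignonRessayre2004, §2] -/
theorem rank_hess0_transl_le_of_isUnit_adjugate {n : ℕ} (l : R →ₗ[ℂ] ℂ)
    (A : Matrix (Fin n) (Fin n) (MvPolynomial σ R)) (F : MvPolynomial σ ℂ)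
    (hA : ∀ a b, (A a b).totalDegree ≤ 1) (hF : ∀ d, l (coeff d A.det) = coeff d F)
    (p : σ → ℂ) (hp : eval (fun i => algebraMap ℂ R (p i)) A.det = 0)
    (hu : ∃ i j, IsUnit ((A.map (eval (fun i => algebraMap ℂ R (p i)))).adjugate i j)) :
    (hess0 (transl p F)).rank ≤ 2 * Module.finrank ℂ R * n := by
  classical
  obtain ⟨i₀, j₀, hunit⟩ := hu
  obtain ⟨u, hu⟩ := hunit
  -- the row `w = adj(A(p))_{i₀ •}` through the unit satisfies `wᵀ A(p) = 0`
  have hdetB : (A.map (eval (fun i => algebraMap ℂ R (p i)))).det = 0 :=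
    (det_map_eval_eq A p).trans hp
  have hwB : ∀ k, ∑ i, (A.map (eval (fun i => algebraMap ℂ R (p i)))).adjugate i₀ i *
      eval (fun i => algebraMap ℂ R (p i)) (A i k) = 0 := by
    intro k
    have h := congr_fun (congr_fun (Matrix.adjugate_mul (A.map (eval (fun i => algebraMap ℂ R (p i))))) i₀) k
    rw [Matrix.mul_apply, hdetB, zero_smul, Matrix.zero_apply] at h
    simpa only [Matrix.map_apply] using h
  have hkey := mul_eval_pderiv_pderiv_det_eq (fun i => algebraMap ℂ R (p i)) A hA _ hwB j₀
  rw [← hu] at hkey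
  -- `Hess F(p)(s,t) = Σ_k (λ(u⁻¹ α_{kt} γ_{ks}) + λ(u⁻¹ α_{ks} γ_{kt}))`
  refine rank_le_of_eq_sum_readOut l (↑u⁻¹ : R)
    (fun k s => eval (fun i => algebraMap ℂ R (p i)) (pderiv s (∑ i, (A.map (eval (fun i =>
        algebraMap ℂ R (p i)))).adjugate i₀ i • A i k)))
    (fun k s => eval (fun i => algebraMap ℂ R (p i)) (pderiv s (A.adjugate k j₀)))
    (hess0 (transl p F)) fun s t => ?_
  rw [hess0_transl_readOut l hF p s t]
  have h2 := hkey s t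
  rw [← Units.eq_inv_mul_iff_mul_eq] at h2
  rw [h2, Finset.mul_sum, map_sum]
  refine Finset.sum_congr rfl fun k _ => ?_
  rw [mul_add, map_add, mul_assoc, mul_assoc]

omit [Fintype σ] [Module.Finite ℂ R] in
/-- In an algebra with a character `φ` of nilpotent kernel, an element with non-zero residue is a
unit (`r = φ(r) + (r - φ(r))`, nilpotent second summand). [folklore] -/
theorem isUnit_of_apply_ne_zero (φ : R →ₐ[ℂ] ℂ) {ν : ℕ} (hker : RingHom.ker (φ : R →+* ℂ) ^ ν = ⊥)
    {r : R} (hr : φ r ≠ 0) : IsUnit r := by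
  have hnil : (r - algebraMap ℂ R (φ r)) ^ ν = 0 :=
    pow_eq_zero_of_ker_pow_eq_bot φ hker (by simp)
  have hu : IsUnit (algebraMap ℂ R (φ r)) := (IsUnit.mk0 _ hr).map _
  have h := IsNilpotent.isUnit_add_left_of_commute ⟨ν, hnil⟩ hu (Commute.all _ _)
  rwa [add_sub_cancel] at h

/-- **Residual form.** With a character `φ` of nilpotent kernel (a local `R`): if some
`(n-1) × (n-1)` minor of the residual value matrix `φ(A(p))` is non-zero — i.e. `A(p) mod 𝔪` has corank
exactly one, given `det A(p) = 0` — then `rank Hess F(p) ≤ 2 · dim R · n`. [cite: MignonRessayre2004, §2] -/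
theorem rank_hess0_transl_le_of_residual_ne_zero {n : ℕ} (φ : R →ₐ[ℂ] ℂ) {ν : ℕ}
    (hker : RingHom.ker (φ : R →+* ℂ) ^ ν = ⊥) (l : R →ₗ[ℂ] ℂ)
    (A : Matrix (Fin n) (Fin n) (MvPolynomial σ R)) (F : MvPolynomial σ ℂ)
    (hA : ∀ a b, (A a b).totalDegree ≤ 1) (hF : ∀ d, l (coeff d A.det) = coeff d F)
    (p : σ → ℂ) (hp : eval (fun i => algebraMap ℂ R (p i)) A.det = 0)
    (hres : ∃ i j, φ ((A.map (eval (fun i => algebraMap ℂ R (p i)))).adjugate i j) ≠ 0) :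
    (hess0 (transl p F)).rank ≤ 2 * Module.finrank ℂ R * n := by
  obtain ⟨i, j, hij⟩ := hres
  exact rank_hess0_transl_le_of_isUnit_adjugate l A F hA hF p hp
    ⟨i, j, isUnit_of_apply_ne_zero φ hker hij⟩

/-- **Linear-entry form, as consumed by `…LocalReduction`** (entries homogeneous of degree `1`):
at every point `p` with `det A(p) = 0` in `R` and a unit `(n-1)`-minor of `A(p)`,
`rank Hess F(p) ≤ 2 · dim R · n`. [cite: MignonRessayre2004, §2] -/
theorem rank_hess0_transl_le_of_isUnit_adjugate_linear {n : ℕ} (l : R →ₗ[ℂ] ℂ)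
    (A : Matrix (Fin n) (Fin n) (MvPolynomial σ R)) (F : MvPolynomial σ ℂ)
    (hA : ∀ a b, (A a b).IsHomogeneous 1) (hF : ∀ d, l (coeff d A.det) = coeff d F)
    (p : σ → ℂ) (hp : eval (fun i => algebraMap ℂ R (p i)) A.det = 0)
    (hu : ∃ i j, IsUnit ((A.map (eval (fun i => algebraMap ℂ R (p i)))).adjugate i j)) :
    (hess0 (transl p F)).rank ≤ 2 * Module.finrank ℂ R * n :=
  rank_hess0_transl_le_of_isUnit_adjugate l A F (fun a b => (hA a b).totalDegree_le) hF p hp hu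

/-! ### Unimodular kernel vectors (appended): the same bound beyond residual corank one -/

/-- **Unimodular LEFT kernel vector form.**  The proof of `rank_hess0_transl_le_of_isUnit_adjugate`
uses the unit minor only to produce a row vector `w ∈ Rⁿ` with a UNIT coordinate and `wᵀ A(p) = 0`.
For any such `w` (and then automatically `det A(p) = 0`): `rank Hess F(p) ≤ 2 · dim R · n`.  This
also covers points of residual corank `≥ 2` whose value matrix has a unimodular left kernel vector
(e.g. `A(p) ≃ diag(1_k, 0_q)`). [cite: MignonRessayre2004, §2] -/
theorem rank_hess0_transl_le_of_vecMul_eq_zero {n : ℕ} (l : R →ₗ[ℂ] ℂ)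
    (A : Matrix (Fin n) (Fin n) (MvPolynomial σ R)) (F : MvPolynomial σ ℂ)
    (hA : ∀ a b, (A a b).totalDegree ≤ 1) (hF : ∀ d, l (coeff d A.det) = coeff d F)
    (p : σ → ℂ) (w : Fin n → R)
    (hw : Matrix.vecMul w (A.map (eval (fun i => algebraMap ℂ R (p i)))) = 0)
    (hu : ∃ j, IsUnit (w j)) :
    (hess0 (transl p F)).rank ≤ 2 * Module.finrank ℂ R * n := by
  classical
  obtain ⟨j₀, hunit⟩ := hu
  obtain ⟨u, hu⟩ := hunit
  have hwB : ∀ k, ∑ i, w i * eval (fun i => algebraMap ℂ R (p i)) (A i k) = 0 := by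
    intro k
    have h := congr_fun hw k
    simpa only [Matrix.vecMul, dotProduct, Matrix.map_apply, Pi.zero_apply] using h
  have hkey := mul_eval_pderiv_pderiv_det_eq (fun i => algebraMap ℂ R (p i)) A hA w hwB j₀
  rw [← hu] at hkey
  refine rank_le_of_eq_sum_readOut l (↑u⁻¹ : R)
    (fun k s => eval (fun i => algebraMap ℂ R (p i)) (pderiv s (∑ i, w i • A i k)))
    (fun k s => eval (fun i => algebraMap ℂ R (p i)) (pderiv s (A.adjugate k j₀)))
    (hess0 (transl p F)) fun s t => ?_
  rw [hess0_transl_readOut l hF p s t]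
  have h2 := hkey s t
  rw [← Units.eq_inv_mul_iff_mul_eq] at h2
  rw [h2, Finset.mul_sum, map_sum]
  refine Finset.sum_congr rfl fun k _ => ?_
  rw [mul_add, map_add, mul_assoc, mul_assoc]

/-- **Unimodular RIGHT kernel vector form** (transpose): if `A(p) w = 0` for a column vector `w`
with a unit coordinate, then `rank Hess F(p) ≤ 2 · dim R · n`. [cite: MignonRessayre2004, §2] -/
theorem rank_hess0_transl_le_of_mulVec_eq_zero {n : ℕ} (l : R →ₗ[ℂ] ℂ)
    (A : Matrix (Fin n) (Fin n) (MvPolynomial σ R)) (F : MvPolynomial σ ℂ)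
    (hA : ∀ a b, (A a b).totalDegree ≤ 1) (hF : ∀ d, l (coeff d A.det) = coeff d F)
    (p : σ → ℂ) (w : Fin n → R)
    (hw : Matrix.mulVec (A.map (eval (fun i => algebraMap ℂ R (p i)))) w = 0)
    (hu : ∃ j, IsUnit (w j)) :
    (hess0 (transl p F)).rank ≤ 2 * Module.finrank ℂ R * n := by
  refine rank_hess0_transl_le_of_vecMul_eq_zero l Aᵀ F (fun a b => hA b a)
    (fun d => by rw [Matrix.det_transpose]; exact hF d) p w ?_ hu
  rw [Matrix.transpose_map, Matrix.vecMul_transpose]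
  exact hw

omit [Algebra ℂ R] [Fintype σ] [Module.Finite ℂ R] in
/-- Under the hypotheses of the unimodular forms the value `det A(p)` vanishes automatically:
`det B · w = (wᵀ B) adj B = 0` and a coordinate of `w` is a unit. [folklore] -/
theorem det_map_eval_eq_zero_of_vecMul_eq_zero {n : ℕ} (B : Matrix (Fin n) (Fin n) R)
    (w : Fin n → R) (hw : Matrix.vecMul w B = 0) (hu : ∃ j, IsUnit (w j)) : B.det = 0 := by
  obtain ⟨j, hj⟩ := hu
  have h : Matrix.vecMul w (B * B.adjugate) = 0 := by
    rw [← Matrix.vecMul_vecMul, hw, Matrix.zero_vecMul]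
  rw [Matrix.mul_adjugate, Matrix.vecMul_smul, Matrix.vecMul_one] at h
  have hj0 : B.det * w j = 0 := by
    have := congr_fun h j
    simpa only [Pi.smul_apply, smul_eq_mul, Pi.zero_apply] using this
  obtain ⟨u, hu⟩ := hj
  rw [← hu] at hj0
  simpa using congrArg (· * (↑u⁻¹ : R)) hj0

end Main

end Summit.ValiantsHypothesis.ValiantsHypothesis.Theorems.GrenetZeonPolySizeQPAlgebra

end
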